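import Summits.KontsevichZagierPeriods.KontsevichZagierPeriods.Theorems.LinRedNormalFormArrangementNormalFormStubSeparateZeroPieceBound
import Summits.KontsevichZagierPeriods.KontsevichZagierPeriods.Theorems.LinRedNormalFormArrangementNormalFormStubSeparateZeroMarginals

/-!
# Stub `stub_separateZero` (crux `ArrangementNormalForm`, line `janus-bands`) — part `GoodPieces`

ABSOLUTE CONVERGENCE ON A GOOD PIECE (`integrableOn_LB_pset`): the letter block is dominated by
the product majorant `1_{[-L,L]}(y) E(y) Λ^k ∏ᵢ ψᵢ(y, tᵢ)`, whose integral is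
`Λ^k K_c^k ∫ E < ∞` (Tonelli, `K_c = ∫₀¹ ω_c`); and order-preserving updates of one fibre
coordinate stay in the piece (used for the bad pieces).
-/

noncomputable section

open Set MeasureTheory
open Literature.NumberTheory.Transcendental
open scoped ENNReal

namespace Summit.KontsevichZagierPeriods.ArrangementNormalForm.JanusBands

namespace SepZero

variable {k : ℕ} {S : Finset Atom}

/-! ### Integrability on a good piece -/

/-- A bound for atom values on `|y| ≤ L`. -/
def Lat (S : Finset Atom) (L : ℝ) : ℝ := ∑ c ∈ S, (|(c.1 0 : ℝ)| * |L| + |(c.2 : ℝ)|)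

/-- `|c(y)| ≤ Lat S L` for `c ∈ S`, `|y| ≤ L`. -/
theorem abs_av_le {c : Atom} (hc : c ∈ S) {y L : ℝ} (hy : |y| ≤ L) : |av c y| ≤ Lat S L := by
  have h1 : |av c y| ≤ |(c.1 0 : ℝ)| * |L| + |(c.2 : ℝ)| := by
    unfold av
    refine (abs_add_le _ _).trans (add_le_add ?_ le_rfl)
    rw [abs_mul]
    exact mul_le_mul_of_nonneg_left (hy.trans (le_abs_self L)) (abs_nonneg _)
  exact h1.trans (Finset.single_le_sum (f := fun c : Atom => |(c.1 0 : ℝ)| * |L| + |(c.2 : ℝ)|)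
    (fun c _ => by positivity) hc)

/-- **Integrability of the letter block on a good piece.** -/
theorem integrableOn_LB_pset {Yb : Set ℝ} (hYb : MeasurableSet Yb) (lo hi : Fin k → Fin k ⊕ Atom)
    (a : Fin k → Option Atom) (ha : ∀ i c, a i = some c → c ∈ S) {L : ℝ}
    (hL : ∀ z ∈ dom Yb lo hi, ∀ j, |z j| ≤ L) (π : Piece k S) (hgood : Good a π) :
    IntegrableOn (LB a) (pset (dom Yb lo hi) S π) := by
  classical
  set D := dom Yb lo hi with hD
  have hDm : MeasurableSet D := measurableSet_dom hYb lo hi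
  have hPm : MeasurableSet (pset D S π) := measurableSet_pset hDm π
  -- constants
  set θ : ℝ := 1 / (2 * k + 2) with hθ
  set cx : ℝ := 1 - θ / (k + 1) with hcx
  set Lw : ℝ := 2 * Lat S L + 1 with hLw
  have hk0 : (0 : ℝ) ≤ k := Nat.cast_nonneg k
  have hθ0 : 0 < θ := by rw [hθ]; positivity
  have hθ1 : θ ≤ 1 := by rw [hθ, div_le_one (by positivity)]; linarith
  have hθn : θ * ((2 * k : ℕ) : ℝ) < 1 := by
    rw [hθ]; push_cast; rw [div_mul_eq_mul_div, one_mul, div_lt_one (by positivity)]; linarith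
  have hcx0 : 0 ≤ cx := by
    rw [hcx, sub_nonneg, div_le_one (by positivity)]; linarith
  have hcx1 : cx ≤ 1 := by rw [hcx]; linarith [div_nonneg hθ0.le (by positivity : (0:ℝ) ≤ k + 1)]
  have hcxlt : cx < 1 := by
    rw [hcx]; linarith [div_pos hθ0 (by positivity : (0:ℝ) < k + 1)]
  have hcard : (k : ℝ) * (1 - cx) + (1 - θ) ≤ cx := by
    rw [hcx]
    have : (k : ℝ) * (θ / (k + 1)) + θ / (k + 1) = θ := by field_simp
    nlinarith
  have hLat0 : 0 ≤ Lat S L := Finset.sum_nonneg fun c _ => by positivity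
  have h1Lw : 1 ≤ Lw := by rw [hLw]; linarith
  -- the majorant
  set g : ℝ → ℝ≥0∞ := (Icc (-L) L).indicator fun y => ENNReal.ofReal (Emaj S θ (2 * k) y * Lw ^ k)
    with hg
  set ψ : Fin k → ℝ → ℝ → ℝ≥0∞ := fun i y t => psi cx (av (π.V i) y) (av (π.W i) y) t with hψ
  have hgm : Measurable g :=
    (((measurable_Emaj S θ _).mul measurable_const).ennreal_ofReal).indicator measurableSet_Icc
  have hψm : ∀ i, Measurable (Function.uncurry (ψ i)) := fun i =>
    measurable_psi cx (measurable_av _) (measurable_av _)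
  -- pointwise bound off the bad base points
  have hpt : ∀ z ∈ pset D S π, z (bo k) ∉ Ybad S →
      ‖LB a z‖ₑ ≤ g (z (bo k)) * ∏ i, ψ i (z (bo k)) (z (fc i)) := by
    intro z hz hyb
    have hzD : z ∈ D := hz.1
    have hyL : |z (bo k)| ≤ L := hL z hzD _
    have hLwi : ∀ i, av (π.W i) (z (bo k)) - av (π.V i) (z (bo k)) ≤ Lw := fun i => by
      have h1 := abs_av_le (π.W_mem i) hyL
      have h2 := abs_av_le (π.V_mem i) hyL
      rw [abs_le] at h1 h2
      rw [hLw]; linarith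
    have hb := abs_LB_le a ha hz hgood (av_ne_of_notMem_Ybad hyb) hθ0 hθ1 hcx0 hcx1 hcard hLwi h1Lw
    have hymem : z (bo k) ∈ Icc (-L) L := abs_le.1 hyL
    rw [hg, indicator_of_mem hymem, Real.enorm_eq_ofReal_abs]
    have hψeq : ∀ i, ψ i (z (bo k)) (z (fc i)) = ENNReal.ofReal (omg cx ((z (fc i) -
        av (π.V i) (z (bo k))) / (av (π.W i) (z (bo k)) - av (π.V i) (z (bo k)))) /
        (av (π.W i) (z (bo k)) - av (π.V i) (z (bo k)))) := fun i => by
      simp only [hψ, psi, indicator_of_mem (show z (fc i) ∈ Ioo _ _ from hz.2.1 i)]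
    have hPnn : ∀ i, 0 ≤ omg cx ((z (fc i) - av (π.V i) (z (bo k))) / (av (π.W i) (z (bo k)) -
        av (π.V i) (z (bo k)))) / (av (π.W i) (z (bo k)) - av (π.V i) (z (bo k))) := fun i => by
      have hbx := hz.2.1 i
      have hΔ : 0 < av (π.W i) (z (bo k)) - av (π.V i) (z (bo k)) := by linarith [hbx.1, hbx.2]
      refine div_nonneg (omg_nonneg _ (div_nonneg (by linarith [hbx.1]) hΔ.le) ?_) hΔ.le
      rw [div_le_one hΔ]; linarith [hbx.2]
    simp_rw [hψeq]
    rw [← ENNReal.ofReal_prod_of_nonneg fun i _ => hPnn i, ← ENNReal.ofReal_mul (by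
      exact mul_nonneg (pow_nonneg (by linarith [Emaj_sum_nonneg S θ (z (bo k))]) _)
        (pow_nonneg (by linarith) _))]
    exact ENNReal.ofReal_le_ofReal hb
  -- a.e. version
  have hae : ∀ᵐ z ∂(volume : Measure (Fin (1 + k) → ℝ)), z ∈ pset D S π →
      ‖LB a z‖ₑ ≤ g (z (bo k)) * ∏ i, ψ i (z (bo k)) (z (fc i)) := by
    have h0 : volume {z : Fin (1 + k) → ℝ | z (bo k) ∈ Ybad S} = 0 :=
      volume_cylinder_eq_zero (bo k) (volume_Ybad S).1 (volume_Ybad S).2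
    filter_upwards [measure_eq_zero_iff_ae_notMem.1 h0] with z hz hzp
    exact hpt z hzp hz
  -- the integral of the majorant
  have hprod := lintegral_prod_fibres (bo k) (fcE k) fc_ne_bo (fun j hj => exists_fc_eq j hj) g hgm ψ hψm
  have hfin : ∫⁻ z : Fin (1 + k) → ℝ, g (z (bo k)) * ∏ i, ψ i (z (bo k)) (z (fc i)) < ⊤ := by
    change ∫⁻ z : Fin (1 + k) → ℝ, g (z (bo k)) * ∏ i, ψ i (z (bo k)) (z ((fcE k) i)) < ⊤
    rw [hprod]
    have hle : ∀ y, g y * ∏ i, ∫⁻ t, ψ i y t ≤ g y * Kc cx ^ k := fun y => by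
      refine mul_le_mul_right ?_ _
      calc ∏ i, ∫⁻ t, ψ i y t ≤ ∏ _i : Fin k, Kc cx :=
            Finset.prod_le_prod' fun i _ => lintegral_psi_le cx _ _
        _ = Kc cx ^ k := by rw [Finset.prod_const, Finset.card_univ, Fintype.card_fin]
    refine lt_of_le_of_lt (lintegral_mono hle) ?_
    rw [lintegral_mul_const _ hgm, hg, lintegral_indicator measurableSet_Icc]
    refine ENNReal.mul_lt_top ?_ (ENNReal.pow_lt_top (Kc_lt_top hcxlt))
    have : ∀ y, ENNReal.ofReal (Emaj S θ (2 * k) y * Lw ^ k) =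
        ENNReal.ofReal (Emaj S θ (2 * k) y) * ENNReal.ofReal (Lw ^ k) := fun y =>
      ENNReal.ofReal_mul (pow_nonneg (by linarith [Emaj_sum_nonneg S θ y]) _)
    simp_rw [this]
    rw [lintegral_mul_const _ (measurable_Emaj S θ _).ennreal_ofReal]
    refine ENNReal.mul_lt_top ?_ ENNReal.ofReal_lt_top
    have := lintegral_base_majorant_lt_top (S ×ˢ S) (fun p : Atom × Atom => (p.1.1 0 : ℝ) - p.2.1 0)
      (fun p => (p.1.2 : ℝ) - p.2.2) L θ (2 * k) hθn
    refine lt_of_le_of_lt (le_of_eq ?_) this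
    refine lintegral_congr fun y => ?_
    simp only [Emaj, Finset.sum_product]
    congr 3
    refine Finset.sum_congr rfl fun c _ => Finset.sum_congr rfl fun c' _ => ?_
    simp only [av]; congr 2; ring
  refine ⟨(measurable_LB a).aestronglyMeasurable, ?_⟩
  rw [hasFiniteIntegral_iff_enorm]
  calc ∫⁻ z in pset D S π, ‖LB a z‖ₑ
      ≤ ∫⁻ z in pset D S π, g (z (bo k)) * ∏ i, ψ i (z (bo k)) (z (fc i)) :=
        setLIntegral_mono_ae ((hgm.comp (measurable_pi_apply _)).mul (Finset.measurable_prod _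
          fun i _ => show Measurable ((Function.uncurry (ψ i)) ∘ fun z : Fin (1 + k) → ℝ =>
            (z (bo k), z (fc i))) from (hψm i).comp ((measurable_pi_apply _).prodMk
            (measurable_pi_apply _)))).aemeasurable hae
    _ ≤ ∫⁻ z : Fin (1 + k) → ℝ, g (z (bo k)) * ∏ i, ψ i (z (bo k)) (z (fc i)) :=
        setLIntegral_le_lintegral _ _
    _ < ⊤ := hfin

variable {Yb : Set ℝ} {lo hi : Fin k → Fin k ⊕ Atom}

/-! ### Order-preserving updates stay in the piece -/

section Update

variable (hlo : ∀ i c, lo i = Sum.inr c → c ∈ S) (hhi : ∀ i c, hi i = Sum.inr c → c ∈ S)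
  {π : Piece k S} {z : Fin (1 + k) → ℝ}

include hlo hhi in
/-- Moving one fibre coordinate inside its box without crossing the other coordinates of its gap
keeps the point in the piece. -/
theorem update_mem_pset (hz : z ∈ pset (dom Yb lo hi) S π) (i : Fin k) {x : ℝ}
    (hx1 : av (π.V i) (z (bo k)) < x) (hx2 : x < av (π.W i) (z (bo k)))
    (hsame : ∀ m, m ≠ i → av (π.V m) (z (bo k)) = av (π.V i) (z (bo k)) →
      (z (fc m) < z (fc i) → z (fc m) < x) ∧ (z (fc i) < z (fc m) → x < z (fc m))) :
    Function.update z (fc i) x ∈ pset (dom Yb lo hi) S π := by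
  set z' := Function.update z (fc i) x with hz'
  have hy : z' (bo k) = z (bo k) := Function.update_of_ne (fc_ne_bo i).symm _ _
  have hxi : z' (fc i) = x := Function.update_self _ _ _
  have hxm : ∀ m, m ≠ i → z' (fc m) = z (fc m) := fun m hm =>
    Function.update_of_ne (fun h => hm (fc_injective h)) _ _
  have hbox := hz.2.1
  -- comparison with every other coordinate is preserved
  have hcmp : ∀ m, m ≠ i → (z (fc m) < z (fc i) → z (fc m) < x) ∧
      (z (fc i) < z (fc m) → x < z (fc m)) := by
    intro m hm
    rcases boxes hz m i with h | h | h
    · have := hbox m; have := hbox i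
      exact ⟨fun _ => by linarith, fun h' => by linarith⟩
    · have := hbox m; have := hbox i
      exact ⟨fun h' => by linarith, fun _ => by linarith⟩
    · exact hsame m hm h.1
  have hbv : ∀ u : Fin k ⊕ Atom, (∀ j, u = Sum.inl j → j ≠ i) → bv z' u = bv z u := by
    intro u hu
    cases u with
    | inl j => exact hxm j (hu j rfl)
    | inr c => simp [bv, hy]
  refine ⟨⟨by rw [hy]; exact hz.1.1, fun m => ?_⟩, fun m => ?_, by rw [hy]; exact hz.2.2.1,
    by rw [hy]; exact hz.2.2.2.1, fun m => ?_, by rw [hy]; exact hz.2.2.2.2.2⟩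
  · -- domain constraints
    have hold := hz.1.2 m
    by_cases hm : m = i
    · subst hm
      rw [hxi]
      constructor
      · cases hl : lo m with
        | inr c =>
          rw [hl] at hold
          simp only [bv, Sum.elim_inr, hy] at hold ⊢
          rcases atom_outside hz m (hlo m c hl) with h | h
          · linarith
          · linarith [(hbox m).2, hold.1]
        | inl j =>
          rw [hl] at hold
          simp only [bv, Sum.elim_inl] at hold ⊢
          have hj : j ≠ m := fun h => by rw [h] at hold; exact lt_irrefl _ hold.1
          rw [hxm j hj]
          exact (hcmp j hj).1 hold.1
      · cases hl : hi m with
        | inr c =>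
          rw [hl] at hold
          simp only [bv, Sum.elim_inr, hy] at hold ⊢
          rcases atom_outside hz m (hhi m c hl) with h | h
          · linarith [(hbox m).1, hold.2]
          · linarith
        | inl j =>
          rw [hl] at hold
          simp only [bv, Sum.elim_inl] at hold ⊢
          have hj : j ≠ m := fun h => by rw [h] at hold; exact lt_irrefl _ hold.2
          rw [hxm j hj]
          exact (hcmp j hj).2 hold.2
    · rw [hxm m hm]
      constructor
      · cases hl : lo m with
        | inr c => rw [hl] at hold; simpa [bv, hy] using hold.1
        | inl j =>
          rw [hl] at hold
          simp only [bv, Sum.elim_inl] at hold ⊢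
          by_cases hj : j = i
          · subst hj; rw [hxi]; exact (hcmp m hm).2 hold.1
          · rw [hxm j hj]; exact hold.1
      · cases hl : hi m with
        | inr c => rw [hl] at hold; simpa [bv, hy] using hold.2
        | inl j =>
          rw [hl] at hold
          simp only [bv, Sum.elim_inl] at hold ⊢
          by_cases hj : j = i
          · subst hj; rw [hxi]; exact (hcmp m hm).1 hold.2
          · rw [hxm j hj]; exact hold.2
  · -- boxes
    rw [hy]
    by_cases hm : m = i
    · subst hm; rw [hxi]; exact ⟨hx1, hx2⟩
    · rw [hxm m hm]; exact hbox m
  · -- strict bottom / top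
    have hold := hz.2.2.2.2.1 m
    constructor
    · rcases hold.1 with h | h
      · exact Or.inl h
      · right
        by_cases hm : m = i
        · subst hm
          have hb : π.β m ≠ m := fun h' => by rw [h'] at h; exact lt_irrefl _ h
          rw [hxi, hxm _ hb]; exact (hcmp _ hb).1 h
        · rw [hxm m hm]
          by_cases hb : π.β m = i
          · rw [hb] at h ⊢; rw [hxi]; exact (hcmp m hm).2 h
          · rw [hxm _ hb]; exact h
    · rcases hold.2 with h | h
      · exact Or.inl h
      · right
        by_cases hm : m = i
        · subst hm
          have hb : π.τ m ≠ m := fun h' => by rw [h'] at h; exact lt_irrefl _ h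
          rw [hxi, hxm _ hb]; exact (hcmp _ hb).2 h
        · rw [hxm m hm]
          by_cases hb : π.τ m = i
          · rw [hb] at h ⊢; rw [hxi]; exact (hcmp m hm).1 h
          · rw [hxm _ hb]; exact h

include hlo hhi in
/-- Lowering the bottom coordinate of a gap inside its box keeps the point in the piece. -/
theorem update_mem_pset_bot (hz : z ∈ pset (dom Yb lo hi) S π) {i : Fin k} (hβ : π.β i = i)
    {x : ℝ} (hx1 : av (π.V i) (z (bo k)) < x) (hx2 : x < z (fc i)) :
    Function.update z (fc i) x ∈ pset (dom Yb lo hi) S π := by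
  refine update_mem_pset hlo hhi hz i hx1 (hx2.trans (hz.2.1 i).2) fun m hm hV => ?_
  have hb : π.β m = i := ((hz.2.2.2.2.2 m i hV).1).trans hβ
  have h : z (fc i) < z (fc m) := by
    rcases (hz.2.2.2.2.1 m).1 with h | h
    · exact absurd (h.symm.trans hb) hm
    · rwa [hb] at h
  exact ⟨fun h' => absurd h' (not_lt.2 h.le), fun _ => hx2.trans h⟩

include hlo hhi in
/-- Raising the top coordinate of a gap inside its box keeps the point in the piece. -/
theorem update_mem_pset_top (hz : z ∈ pset (dom Yb lo hi) S π) {i : Fin k} (hτ : π.τ i = i)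
    {x : ℝ} (hx1 : z (fc i) < x) (hx2 : x < av (π.W i) (z (bo k))) :
    Function.update z (fc i) x ∈ pset (dom Yb lo hi) S π := by
  refine update_mem_pset hlo hhi hz i ((hz.2.1 i).1.trans hx1) hx2 fun m hm hV => ?_
  have hb : π.τ m = i := ((hz.2.2.2.2.2 m i hV).2).trans hτ
  have h : z (fc m) < z (fc i) := by
    rcases (hz.2.2.2.2.1 m).2 with h | h
    · exact absurd (h.symm.trans hb) hm
    · rwa [hb] at h
  exact ⟨fun _ => h.trans hx1, fun h' => absurd h' (not_lt.2 h.le)⟩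

end Update

end SepZero

/-- Registered support goal of this file: absolute convergence of the letter block on a good piece. -/
theorem separateZero_goodPieces (k : ℕ) (S : Finset SepZero.Atom) (Yb : Set ℝ) (hYb : MeasurableSet Yb) (lo hi : Fin k → Fin k ⊕ SepZero.Atom) (a : Fin k → Option SepZero.Atom) (ha : ∀ i c, a i = some c → c ∈ S) (L : ℝ) (hL : ∀ z ∈ SepZero.dom Yb lo hi, ∀ j, |z j| ≤ L) (π : SepZero.Piece k S) (hgood : SepZero.Good a π) : MeasureTheory.IntegrableOn (SepZero.LB a) (SepZero.pset (SepZero.dom Yb lo hi) S π) :=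
  SepZero.integrableOn_LB_pset hYb lo hi a ha hL π hgood

end Summit.KontsevichZagierPeriods.ArrangementNormalForm.JanusBands
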